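import Summits.CriticalPhenomena.SAWScalingLimit.Theorems.SAWDevelopingMapObservableToSLETypeLadderBandPrefixConditioning
import Summits.CriticalPhenomena.SAWScalingLimit.Theorems.SAWDevelopingMapObservableToSLETypeLadderBandGoodRenewal
import HarnessLib

/-!
# Reversal pieces of the band iteration (two-end assembly, pieces of I8)

Stubs `stub_hexSAWLaw_reverse_apply` and `stub_backtrackEvent_reverse` (line `six-class-type-ladder`,
skeleton r16: band-wise cut of the abundance residue) of the crux
`Summit.CriticalPhenomena.SAWScalingLimit.Theses.SAWDevelopingMap.ObservableToSLE`
(item stmt-CriticalPhenomena-10472).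

The two-end assembly of the band iteration treats the far endpoint `b` by reading the walk BACKWARDS.
Two pieces of pure bookkeeping are needed.

* `stub_hexSAWLaw_reverse_apply` — **reversal symmetry of the critical SAW law on list events**: for every
  property `E` of the LIST of visited vertices, the `hexSAWLaw Ω δ x y`-mass of `{γ | E (support γ).reverse}`
  equals the `hexSAWLaw Ω δ y x`-mass of `{γ | E (support γ)}`.  Reversal `γ ↦ γ.reverse` is a bijection from
  the self-avoiding walks `y → x` of `Ω_δ` onto those `x → y` preserving the number of visited vertices, hence
  the weight `x_c ^ ℓ(γ)`; the weights are evaluated as `tsum`s, so NO finiteness of the walk space is needed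
  (arbitrary `Ω`), and the normalisations `W univ` agree as the special case `E := fun _ => True`.
  Madras–Slade 1993 §1.2 (reversal symmetry); Duminil-Copin–Smirnov 2012 §4 (the weights `x_c^{ℓ(γ)}`).
* `stub_backtrackEvent_reverse` — the macroscopic-backtracking event "an entry `u` that is `r`-close to `z`,
  LATER an entry `v` that is `R′`-far from `z`" for a list `l` is the event "an entry `R′`-far, LATER an entry
  `r`-close" for `l.reverse` (`(l₁ ++ u :: l₂).reverse = l₂.reverse ++ u :: l₁.reverse`).

Helpers: `hexSAWWeight_reverse_apply` (the un-normalised identity, reversal bijection built inside the proof),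
`exists_split_reverse` (the generic list lemma behind the second stub).
-/

noncomputable section

open scoped BigOperators Topology NNReal ENNReal Classical
open Filter Set MeasureTheory Metric
open Literature.Probability.LatticeModels (HexVertex hexGraph hexCenter triZeta Site)
open Literature.Probability.RandomPlanarGeometry
open Literature.Probability.RandomPlanarGeometry.SAW

namespace Summit.CriticalPhenomena.SAWScalingLimit.Theorems.ObservableToSLE.TypeLadder

open Summit.CriticalPhenomena.SAWScalingLimit.Theorems.ObservableToSLER.BridgeGate (embWeight_apply_eq_tsum)

/-! ### Reversal symmetry of the critical SAW weight and law on list events -/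

-- the reversal bijection is adapted from `exists_reverseEquiv` (…TypeLadderCarvedReductionSqueezeReverse)
-- and `sawReverseEquiv` (HexConjecture.Negative.Reversal); it is produced inside the proof (an existential,
-- no new definition) to keep the import closure of the band iteration light.
/-- **Reversal symmetry of the critical SAW weight on list events** (no finiteness needed): the
`hexSAWWeight Ω δ x y`-mass of `{γ | E (support γ).reverse}` is the `hexSAWWeight Ω δ y x`-mass of
`{γ | E (support γ)}` — reversal is a weight-preserving bijection between the two events. -/
theorem hexSAWWeight_reverse_apply (Ω : Set ℂ) (δ : ℝ) (x y : HexVertex) (E : List HexVertex → Prop) :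
    hexSAWWeight Ω δ x y {γ | E γ.walk.support.reverse} = hexSAWWeight Ω δ y x {γ | E γ.walk.support} := by
  obtain ⟨e₀, he₀⟩ : ∃ e₀ : HexDomainSAW Ω δ y x ≃ HexDomainSAW Ω δ x y, ∀ γ, (e₀ γ).walk = γ.walk.reverse :=
    ⟨⟨fun γ => ⟨γ.walk.reverse, γ.isPath.reverse⟩, fun γ => ⟨γ.walk.reverse, γ.isPath.reverse⟩,
      fun γ => by cases γ; simp, fun γ => by cases γ; simp⟩, fun _ => rfl⟩
  have hcount : ∀ γ, (e₀ γ).vertexCount = γ.vertexCount := fun γ => by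
    simp [EmbDomainSAW.vertexCount, EmbDomainSAW.length, he₀, SimpleGraph.Walk.length_reverse]
  set A : Set (HexDomainSAW Ω δ x y) := {γ | E γ.walk.support.reverse} with hA
  set A' : Set (HexDomainSAW Ω δ y x) := {γ | E γ.walk.support} with hA'
  have hiff : ∀ γ : HexDomainSAW Ω δ y x, γ ∈ A' ↔ e₀ γ ∈ A := by
    intro γ
    simp only [hA, hA', Set.mem_setOf_eq, he₀, SimpleGraph.Walk.support_reverse, List.reverse_reverse]
  let e : A' ≃ A := e₀.subtypeEquiv hiff
  rw [hexSAWWeight, embWeight_apply_eq_tsum, embWeight_apply_eq_tsum, ← e.tsum_eq]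
  refine tsum_congr fun γ => ?_
  rw [Equiv.subtypeEquiv_apply, hcount]

/-- **Reversal symmetry of the critical SAW law on list events** (registered stub
`stub_hexSAWLaw_reverse_apply`, crux item stmt-CriticalPhenomena-10472, skeleton r16, band iteration I8):
for every `Ω`, `δ`, endpoints `x y` and every property `E` of the list of visited vertices,
`hexSAWLaw Ω δ x y {γ | E (support γ).reverse} = hexSAWLaw Ω δ y x {γ | E (support γ)}` — the weights agree
by `hexSAWWeight_reverse_apply`, and so do the normalisations (the case `E := fun _ => True`). -/
theorem stub_hexSAWLaw_reverse_apply :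
    ∀ (Ω : Set ℂ) (δ : ℝ) (x y : HexVertex) (E : List HexVertex → Prop),
      hexSAWLaw Ω δ x y {γ | E γ.walk.support.reverse} = hexSAWLaw Ω δ y x {γ | E γ.walk.support} := by
  intro Ω δ x y E
  have huniv : hexSAWWeight Ω δ x y Set.univ = hexSAWWeight Ω δ y x Set.univ := by
    have h := hexSAWWeight_reverse_apply Ω δ x y (fun _ => True)
    simpa using h
  show (hexSAWWeight Ω δ x y Set.univ)⁻¹ * hexSAWWeight Ω δ x y {γ | E γ.walk.support.reverse} =
    (hexSAWWeight Ω δ y x Set.univ)⁻¹ * hexSAWWeight Ω δ y x {γ | E γ.walk.support}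
  rw [huniv, hexSAWWeight_reverse_apply]

/-! ### The macroscopic-backtracking event read backwards -/

/-- **An earlier/later pair read backwards.**  If `l` has an entry `u` with `P u` and a LATER entry `v` with
`Q v` (`l = l₁ ++ u :: l₂`, `v ∈ l₂`), then `l.reverse` has an entry with `Q` and a LATER entry with `P`:
`l.reverse = l₂.reverse ++ u :: l₁.reverse` and `v` sits inside `l₂.reverse`, before `u`. -/
theorem exists_split_reverse {α : Type*} (P Q : α → Prop) (l : List α)
    (h : ∃ (l₁ l₂ : List α) (u v : α), l = l₁ ++ u :: l₂ ∧ v ∈ l₂ ∧ P u ∧ Q v) :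
    ∃ (l₁ l₂ : List α) (u v : α), l.reverse = l₁ ++ u :: l₂ ∧ v ∈ l₂ ∧ Q u ∧ P v := by
  obtain ⟨l₁, l₂, u, v, rfl, hv, hPu, hQv⟩ := h
  obtain ⟨m₁, m₂, hm⟩ := List.append_of_mem (List.mem_reverse.2 hv)
  refine ⟨m₁, m₂ ++ u :: l₁.reverse, v, u, ?_, by simp, hQv, hPu⟩
  simp [List.reverse_append, hm]

/-- **The macroscopic-backtracking event read backwards** (registered stub `stub_backtrackEvent_reverse`,
crux item stmt-CriticalPhenomena-10472, skeleton r16, band iteration I8): the list `l` has an entry `u`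
that is `r`-close to `z` followed LATER by an entry `v` that is `R′`-far from `z` iff `l.reverse` has an
entry `R′`-far from `z` followed LATER by an entry `r`-close to `z` (`exists_split_reverse` both ways,
`l.reverse.reverse = l`). -/
theorem stub_backtrackEvent_reverse :
    ∀ (δ R' r : ℝ) (z : ℂ) (l : List HexVertex),
      (∃ (l₁ l₂ : List HexVertex) (u v : HexVertex), l = l₁ ++ u :: l₂ ∧ v ∈ l₂ ∧
          dist ((δ : ℂ) * hexCenter u) z ≤ r ∧ R' ≤ dist ((δ : ℂ) * hexCenter v) z) ↔
      (∃ (l₁ l₂ : List HexVertex) (u v : HexVertex), l.reverse = l₁ ++ u :: l₂ ∧ v ∈ l₂ ∧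
          R' ≤ dist ((δ : ℂ) * hexCenter u) z ∧ dist ((δ : ℂ) * hexCenter v) z ≤ r) := by
  intro δ R' r z l
  constructor
  · exact exists_split_reverse (fun u => dist ((δ : ℂ) * hexCenter u) z ≤ r)
      (fun v => R' ≤ dist ((δ : ℂ) * hexCenter v) z) l
  · intro h
    have h' := exists_split_reverse (fun u => R' ≤ dist ((δ : ℂ) * hexCenter u) z)
      (fun v => dist ((δ : ℂ) * hexCenter v) z ≤ r) l.reverse h
    rwa [List.reverse_reverse] at h'

end Summit.CriticalPhenomena.SAWScalingLimit.Theorems.ObservableToSLE.TypeLadder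

end
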